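import Mathlib
import Literature.Analysis.FluidPDE.GigaMiura2011ScaledAlignmentBlowupLimitHolds
import Literature.Analysis.Calculus.DerivativeInterpolation
import HarnessLib

/-!
# TypeILiouvilleQuiescentGradient — crux (L) stmt-NavierStokesRegularity-10661 `TypeIliouvilleL`, registered stub
# `stub_quiescentLiouville` (L_Q): THE C⁰ DIAL IS THE C¹ DIAL — quiescent ⟺ uniformly fading velocity GRADIENT

Helper for stmt-NavierStokesRegularity-10661 (`--supports`); route-independent (no `Theses` import); closes no item;
Navier–Stokes regularity is NOT proved here.

The registered residual L_Q = `stub_quiescentLiouville` of the (L)-crux is stated with a `C⁰` dial: the UNIT-SCALE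
OSCILLATION `sup_{dist x y ≤ 1} ‖v(t,x) − v(t,y)‖` of a field of print's class P (continuous on `t < 0`, bounded,
weakly divergence-free slices, heat/Oseen–Duhamel mild identity) tends to `0` as `t → −∞`.  Every mechanism proposed
against L_Q so far is a `C¹` mechanism — the vorticity / strain bookkeeping (weak maximum principle for `|ω|²`,
«strain ledger» `Ω₀ · exp ∫ λ_max(S)`, the Type-I stretching thresholds of `ClockStretchingLaw.SmallStrainRung` /
`SubcriticalStrain`) reads `∇v`, not oscillations.  This file supplies the bridge, in the kernel, on print's class:

* §1 (pure calculus) `norm_fderiv_le_of_osc` — **Landau's inequality with an OSCILLATION**: for a smooth `f` with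
  `‖D²f‖ ≤ M₂` everywhere and `‖f y − f p‖ ≤ ε` on `ball p r`, `‖Df(p)‖ ≤ 2ε/s + s·M₂` for every `0 < s < r`
  (the tree's `Literature.Analysis.Calculus.norm_iteratedFDeriv_succ_le_of_bounds` applied to `f − f p`).
* §2 `contDiff_slice_of_classP`, `exists_norm_iteratedFDeriv_two_le_of_classP` — class P fields have smooth slices
  with a UNIFORM `C²` bound (the tree's `smooth_and_bounds_of_bounded_ancient_oseenMild`, KNSS 2009 regularity of
  bounded ancient mild solutions).
* §3 `fderiv_small_of_quiescent` — **in class P, QUIESCENT ⟹ `sup_x ‖∇v(t,x)‖ → 0` as `t → −∞`** (choose the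
  Landau scale `s ~ δ/M₂`, then the oscillation tolerance `ε ~ s δ`); `quiescent_of_fderiv_small` — the converse
  (mean value inequality); so on class P the two dials coincide (`quiescent_iff_fderiv_small`).
* §4 `quiescentLiouville_iff_gradientFading` — **L_Q ⟺ GRADIENT-FADING LIOUVILLE** («every class-P field with
  `sup_x ‖∇v(t,x)‖ → 0` as `t → −∞` is one constant vector»), exact and unconditional: the registered stub may be
  attacked in `C¹` currency (vorticity `|ω| ≤ 2‖∇v‖ → 0`, strain `λ_max(S) ≤ ‖∇v‖ → 0`, uniformly in `x`) at no cost.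

READING.  This is structure OF the residual, not a reduction of it: L_Q stays open (it contains door stmt-4050,
`TypeILiouvilleSelfSimilarFloorStrata.tfl_of_quiescentLiouville`).  What it buys: the strain-ledger divergence
`∫_s^t λ_max(S) → ∞` (needed by any non-constant quiescent field) must now be produced by a strain that tends to ZERO
uniformly — a harmonic-or-slower tail `λ_max(S)(τ) ≳ 1/|τ|` is forced, i.e. exactly the Type-I-rate boundary of
stmt-4050; faster-than-harmonic gradient decay is EMPTY (integrable ledger ⟹ vorticity extinction ⟹ constant, the
starved cell).  [folklore — Landau 1913 interpolation + KNSS 2009 derivative bounds for bounded ancient mild solutions;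
cite: KochNadirashviliSereginSverak2009, §4 (arXiv:0709.3599)]
-/

noncomputable section
open MeasureTheory Filter Set Function Metric
open scoped Topology NNReal ContDiff
open Literature.Analysis Literature.Analysis.FluidPDE Literature.Analysis.UnboundedOperators
set_option linter.dupNamespace false
namespace Summit.NavierStokesRegularity.NavierStokesRegularity.Theorems.TypeILiouvilleQuiescentGradient

/-! ## §1 Landau's inequality with an oscillation (pure calculus) -/

section Landau

variable {P : Type*} [NormedAddCommGroup P] [NormedSpace ℝ P]
variable {G : Type*} [NormedAddCommGroup G] [NormedSpace ℝ G]

/-- **Landau's inequality with an OSCILLATION bound.** For a smooth `f` with `‖D² f‖ ≤ M₂` everywhere and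
`‖f y − f p‖ ≤ ε` on `ball p r`, one has `‖Df(p)‖ ≤ 2 ε / s + s M₂` for every `0 < s < r`: apply the tree's
Landau inequality between orders `0, 1, 2` (`norm_iteratedFDeriv_succ_le_of_bounds`) to `f − f p`, whose second
derivative is that of `f`. [folklore] -/
theorem norm_fderiv_le_of_osc {f : P → G} (hf : ContDiff ℝ ∞ f) {p : P} {r ε M₂ : ℝ}
    (hM₂ : 0 ≤ M₂) (h2 : ∀ y, ‖iteratedFDeriv ℝ 2 f y‖ ≤ M₂)
    (hosc : ∀ y ∈ ball p r, ‖f y - f p‖ ≤ ε) {s : ℝ} (hs : 0 < s) (hsr : s < r) :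
    ‖fderiv ℝ f p‖ ≤ 2 * ε / s + s * M₂ := by
  set g : P → G := fun y => f y - f p with hg_def
  have hg : ContDiff ℝ ∞ g := hf.sub contDiff_const
  have h0 : ∀ y ∈ ball p r, ‖iteratedFDeriv ℝ 0 g y‖ ≤ ε := fun y hy => by
    rw [norm_iteratedFDeriv_zero]
    exact hosc y hy
  have hf2 : ContDiff ℝ 2 f := contDiff_infty.1 hf 2
  have h2g : ∀ y ∈ ball p r, ‖iteratedFDeriv ℝ 2 g y‖ ≤ M₂ := fun y _ => by
    have hfy : ContDiffAt ℝ 2 f y := hf2.contDiffAt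
    have hcy : ContDiffAt ℝ 2 (fun _ : P => f p) y := contDiffAt_const
    have hsub : iteratedFDeriv ℝ 2 g y = iteratedFDeriv ℝ 2 f y - iteratedFDeriv ℝ 2 (fun _ : P => f p) y := by
      rw [show g = f - fun _ => f p from rfl]
      exact iteratedFDeriv_sub_apply hfy hcy
    have hconst : iteratedFDeriv ℝ 2 (fun _ : P => f p) y = 0 := by
      rw [iteratedFDeriv_const_of_ne (by norm_num : (2 : ℕ) ≠ 0)]
      rfl
    rw [hsub, hconst, sub_zero]
    exact h2 y
  have h : ‖iteratedFDeriv ℝ 1 g p‖ ≤ 2 * ε / s + s * M₂ :=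
    Literature.Analysis.Calculus.norm_iteratedFDeriv_succ_le_of_bounds hg hM₂ (k := 0) h0 h2g hs hsr
  rw [norm_iteratedFDeriv_one] at h
  have hfd : fderiv ℝ g p = fderiv ℝ f p := by
    rw [hg_def]
    exact fderiv_sub_const (f p)
  rwa [hfd] at h

/-- **Mean value form of the converse**: a differentiable `f` with `‖Df‖ ≤ δ` everywhere oscillates by at most `δ`
on pairs at distance `≤ 1`. [folklore] -/
theorem osc_le_of_norm_fderiv_le {f : P → G} (hf : Differentiable ℝ f) {δ : ℝ}
    (hδ : ∀ y, ‖fderiv ℝ f y‖ ≤ δ) (x y : P) (hxy : dist x y ≤ 1) : ‖f x - f y‖ ≤ δ := by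
  have hδ0 : 0 ≤ δ := (norm_nonneg _).trans (hδ x)
  have h := (convex_univ (𝕜 := ℝ) (E := P)).norm_image_sub_le_of_norm_fderiv_le
    (fun z _ => hf z) (fun z _ => hδ z) (mem_univ y) (mem_univ x)
  calc ‖f x - f y‖ ≤ δ * ‖x - y‖ := h
    _ ≤ δ * 1 := by
        refine mul_le_mul_of_nonneg_left ?_ hδ0
        rwa [← dist_eq_norm]
    _ = δ := mul_one δ

end Landau

/-! ## §2 Print's class: smooth slices with a uniform `C²` bound -/

section ClassP

variable {v : ℝ → EuclideanSpace ℝ (Fin 3) → EuclideanSpace ℝ (Fin 3)}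

/-- Slices of a class-P field are smooth (KNSS 2009 regularity of bounded ancient mild solutions, tree
`smooth_and_bounds_of_bounded_ancient_oseenMild`). [cite: KochNadirashviliSereginSverak2009, §4] -/
theorem contDiff_slice_of_classP
    (hcont : ContinuousOn (uncurry v) (Iio 0 ×ˢ univ))
    (hbdd : ∃ K : ℝ, ∀ t < 0, ∀ x, ‖v t x‖ ≤ K)
    (hdiv : ∀ t < 0, Literature.Analysis.FluidPDE.IsWeaklyDivFree (v t))
    (hmild : ∀ s t : ℝ, s < t → t < 0 → ∀ x,
      v t x = Literature.Analysis.UnboundedOperators.heatExtension (v s) (t - s) x -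
        Literature.Analysis.FluidPDE.oseenDuhamel 1 s v v t x)
    {t : ℝ} (ht : t < 0) : ContDiff ℝ ∞ (v t) := by
  obtain ⟨K, hK⟩ := hbdd
  have hcd := (smooth_and_bounds_of_bounded_ancient_oseenMild hcont hdiv hmild hK).1
  have h : ContDiff ℝ (⊤ : ℕ∞) (fun y : EuclideanSpace ℝ (Fin 3) => uncurry v (t, y)) :=
    hcd.comp_contDiff (contDiff_const.prodMk contDiff_id) fun y => ⟨ht, mem_univ y⟩
  exact h

/-- A uniform `C²` bound on the slices of a class-P field (same source). [cite: KochNadirashviliSereginSverak2009, §4] -/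
theorem exists_norm_iteratedFDeriv_two_le_of_classP
    (hcont : ContinuousOn (uncurry v) (Iio 0 ×ˢ univ))
    (hbdd : ∃ K : ℝ, ∀ t < 0, ∀ x, ‖v t x‖ ≤ K)
    (hdiv : ∀ t < 0, Literature.Analysis.FluidPDE.IsWeaklyDivFree (v t))
    (hmild : ∀ s t : ℝ, s < t → t < 0 → ∀ x,
      v t x = Literature.Analysis.UnboundedOperators.heatExtension (v s) (t - s) x -
        Literature.Analysis.FluidPDE.oseenDuhamel 1 s v v t x) :
    ∃ M₂ : ℝ, 0 ≤ M₂ ∧ ∀ t < 0, ∀ x, ‖iteratedFDeriv ℝ 2 (v t) x‖ ≤ M₂ := by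
  obtain ⟨K, hK⟩ := hbdd
  obtain ⟨C, hC⟩ := (smooth_and_bounds_of_bounded_ancient_oseenMild hcont hdiv hmild hK).2 2
  exact ⟨max C 0, le_max_right _ _, fun t ht x => (hC t ht x).trans (le_max_left _ _)⟩

/-! ## §3 Quiescent ⟺ uniformly fading gradient (class P) -/

/-- **QUIESCENT ⟹ UNIFORMLY FADING GRADIENT (class P).** If the unit-scale oscillation of the slices tends to `0`
as `t → −∞`, then so does `sup_x ‖∇v(t,x)‖`: given `δ > 0`, take the Landau scale
`s = min (1/2) (δ / (2 (M₂ + 1)))` (`M₂` = the uniform `C²` bound of §2) and the oscillation tolerance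
`ε = s δ / 4`; then `2ε/s + s M₂ ≤ δ/2 + δ/2`. [folklore; cite: KochNadirashviliSereginSverak2009, §4] -/
theorem fderiv_small_of_quiescent
    (hcont : ContinuousOn (uncurry v) (Iio 0 ×ˢ univ))
    (hbdd : ∃ K : ℝ, ∀ t < 0, ∀ x, ‖v t x‖ ≤ K)
    (hdiv : ∀ t < 0, Literature.Analysis.FluidPDE.IsWeaklyDivFree (v t))
    (hmild : ∀ s t : ℝ, s < t → t < 0 → ∀ x,
      v t x = Literature.Analysis.UnboundedOperators.heatExtension (v s) (t - s) x -
        Literature.Analysis.FluidPDE.oseenDuhamel 1 s v v t x)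
    (hq : ∀ ε : ℝ, 0 < ε → ∃ T : ℝ, T < 0 ∧ ∀ t < T, ∀ x y : EuclideanSpace ℝ (Fin 3),
      dist x y ≤ 1 → ‖v t x - v t y‖ ≤ ε) :
    ∀ δ : ℝ, 0 < δ → ∃ T : ℝ, T < 0 ∧ ∀ t < T, ∀ x, ‖fderiv ℝ (v t) x‖ ≤ δ := by
  intro δ hδ
  obtain ⟨M₂, hM₂, hD2⟩ := exists_norm_iteratedFDeriv_two_le_of_classP hcont hbdd hdiv hmild
  set s : ℝ := min (1 / 2) (δ / (2 * (M₂ + 1))) with hs_def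
  have hs : 0 < s := lt_min (by norm_num) (by positivity)
  have hs1 : s < 1 := (min_le_left _ _).trans_lt (by norm_num)
  have hsM : s * M₂ ≤ δ / 2 := by
    have h1 : s ≤ δ / (2 * (M₂ + 1)) := min_le_right _ _
    calc s * M₂ ≤ δ / (2 * (M₂ + 1)) * M₂ := mul_le_mul_of_nonneg_right h1 hM₂
      _ ≤ δ / (2 * (M₂ + 1)) * (M₂ + 1) := mul_le_mul_of_nonneg_left (by linarith) (by positivity)
      _ = δ / 2 := by field_simp
  obtain ⟨T, hT0, hT⟩ := hq (s * δ / 4) (by positivity)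
  refine ⟨T, hT0, fun t ht x => ?_⟩
  have ht0 : t < 0 := ht.trans hT0
  have hf : ContDiff ℝ ∞ (v t) := contDiff_slice_of_classP hcont hbdd hdiv hmild ht0
  have hosc : ∀ y ∈ ball x (1 : ℝ), ‖v t y - v t x‖ ≤ s * δ / 4 := fun y hy =>
    hT t ht y x (le_of_lt (mem_ball.1 hy))
  have h := norm_fderiv_le_of_osc hf hM₂ (hD2 t ht0) hosc hs hs1
  calc ‖fderiv ℝ (v t) x‖ ≤ 2 * (s * δ / 4) / s + s * M₂ := h
    _ = δ / 2 + s * M₂ := by field_simp; ring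
    _ ≤ δ / 2 + δ / 2 := add_le_add le_rfl hsM
    _ = δ := by ring

/-- **Uniformly fading gradient ⟹ quiescent (class P)** — the mean value inequality on the smooth slices. -/
theorem quiescent_of_fderiv_small
    (hcont : ContinuousOn (uncurry v) (Iio 0 ×ˢ univ))
    (hbdd : ∃ K : ℝ, ∀ t < 0, ∀ x, ‖v t x‖ ≤ K)
    (hdiv : ∀ t < 0, Literature.Analysis.FluidPDE.IsWeaklyDivFree (v t))
    (hmild : ∀ s t : ℝ, s < t → t < 0 → ∀ x,
      v t x = Literature.Analysis.UnboundedOperators.heatExtension (v s) (t - s) x -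
        Literature.Analysis.FluidPDE.oseenDuhamel 1 s v v t x)
    (hg : ∀ δ : ℝ, 0 < δ → ∃ T : ℝ, T < 0 ∧ ∀ t < T, ∀ x, ‖fderiv ℝ (v t) x‖ ≤ δ) :
    ∀ ε : ℝ, 0 < ε → ∃ T : ℝ, T < 0 ∧ ∀ t < T, ∀ x y : EuclideanSpace ℝ (Fin 3),
      dist x y ≤ 1 → ‖v t x - v t y‖ ≤ ε := by
  intro ε hε
  obtain ⟨T, hT0, hT⟩ := hg ε hε
  refine ⟨T, hT0, fun t ht x y hxy => ?_⟩
  have hf : Differentiable ℝ (v t) :=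
    (contDiff_slice_of_classP hcont hbdd hdiv hmild (ht.trans hT0)).differentiable (by simp)
  exact osc_le_of_norm_fderiv_le hf (hT t ht) x y hxy

/-- **On class P the `C⁰` dial and the `C¹` dial coincide**: quiescent ⟺ uniformly fading gradient. -/
theorem quiescent_iff_fderiv_small
    (hcont : ContinuousOn (uncurry v) (Iio 0 ×ˢ univ))
    (hbdd : ∃ K : ℝ, ∀ t < 0, ∀ x, ‖v t x‖ ≤ K)
    (hdiv : ∀ t < 0, Literature.Analysis.FluidPDE.IsWeaklyDivFree (v t))
    (hmild : ∀ s t : ℝ, s < t → t < 0 → ∀ x,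
      v t x = Literature.Analysis.UnboundedOperators.heatExtension (v s) (t - s) x -
        Literature.Analysis.FluidPDE.oseenDuhamel 1 s v v t x) :
    (∀ ε : ℝ, 0 < ε → ∃ T : ℝ, T < 0 ∧ ∀ t < T, ∀ x y : EuclideanSpace ℝ (Fin 3),
      dist x y ≤ 1 → ‖v t x - v t y‖ ≤ ε) ↔
    (∀ δ : ℝ, 0 < δ → ∃ T : ℝ, T < 0 ∧ ∀ t < T, ∀ x, ‖fderiv ℝ (v t) x‖ ≤ δ) :=
  ⟨fderiv_small_of_quiescent hcont hbdd hdiv hmild, quiescent_of_fderiv_small hcont hbdd hdiv hmild⟩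

end ClassP

/-! ## §4 L_Q ⟺ GRADIENT-FADING LIOUVILLE (exact, unconditional) -/

/-- **The registered residual `stub_quiescentLiouville` (L_Q, binders VERBATIM) is EQUIVALENT to GRADIENT-FADING
LIOUVILLE**: «every class-P field with `sup_x ‖∇v(t,x)‖ → 0` as `t → −∞` is one constant vector». So L_Q may be
attacked in `C¹` currency (vorticity and strain tend to `0` uniformly in space as `t → −∞`) at no cost. -/
theorem quiescentLiouville_iff_gradientFading :
    (∀ v : ℝ → EuclideanSpace ℝ (Fin 3) → EuclideanSpace ℝ (Fin 3),
      ContinuousOn (Function.uncurry v) (Set.Iio 0 ×ˢ Set.univ) →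
      (∃ K : ℝ, ∀ t < 0, ∀ x, ‖v t x‖ ≤ K) →
      (∀ t < 0, Literature.Analysis.FluidPDE.IsWeaklyDivFree (v t)) →
      (∀ s t : ℝ, s < t → t < 0 → ∀ x,
        v t x = Literature.Analysis.UnboundedOperators.heatExtension (v s) (t - s) x -
          Literature.Analysis.FluidPDE.oseenDuhamel 1 s v v t x) →
      (∀ ε : ℝ, 0 < ε → ∃ T : ℝ, T < 0 ∧ ∀ t < T, ∀ x y : EuclideanSpace ℝ (Fin 3),
        dist x y ≤ 1 → ‖v t x - v t y‖ ≤ ε) →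
      ∃ b : EuclideanSpace ℝ (Fin 3), ∀ t < 0, ∀ x, v t x = b) ↔
    (∀ v : ℝ → EuclideanSpace ℝ (Fin 3) → EuclideanSpace ℝ (Fin 3),
      ContinuousOn (Function.uncurry v) (Set.Iio 0 ×ˢ Set.univ) →
      (∃ K : ℝ, ∀ t < 0, ∀ x, ‖v t x‖ ≤ K) →
      (∀ t < 0, Literature.Analysis.FluidPDE.IsWeaklyDivFree (v t)) →
      (∀ s t : ℝ, s < t → t < 0 → ∀ x,
        v t x = Literature.Analysis.UnboundedOperators.heatExtension (v s) (t - s) x -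
          Literature.Analysis.FluidPDE.oseenDuhamel 1 s v v t x) →
      (∀ δ : ℝ, 0 < δ → ∃ T : ℝ, T < 0 ∧ ∀ t < T, ∀ x, ‖fderiv ℝ (v t) x‖ ≤ δ) →
      ∃ b : EuclideanSpace ℝ (Fin 3), ∀ t < 0, ∀ x, v t x = b) := by
  constructor
  · intro hLQ v hc hK hd hm hg
    exact hLQ v hc hK hd hm (quiescent_of_fderiv_small hc hK hd hm hg)
  · intro hGF v hc hK hd hm hq
    exact hGF v hc hK hd hm (fderiv_small_of_quiescent hc hK hd hm hq)

/-! ## §5 The bridge in STRAIN-LEDGER currency (appended): quiescent ⟹ the strain majorant tends to `0` -/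

section Strain

open scoped RealInnerProductSpace

variable {v : ℝ → EuclideanSpace ℝ (Fin 3) → EuclideanSpace ℝ (Fin 3)}

/-- A bound on the operator norm of the velocity gradient is a STRAIN MAJORANT: `‖∇v(t,x)‖ ≤ δ` gives
`⟪∇v(t,x) ξ, ξ⟫ ≤ δ ‖ξ‖²` for every `ξ` (Cauchy–Schwarz), i.e. `λ_max (sym ∇v(t,x)) ≤ δ` — the shape of the majorant
`Λ` consumed by the strain-ledger / vorticity-amplification bookkeeping. [folklore] -/
theorem inner_fderiv_le_of_norm_fderiv_le {t : ℝ} {x : EuclideanSpace ℝ (Fin 3)} {δ : ℝ}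
    (h : ‖fderiv ℝ (v t) x‖ ≤ δ) (ξ : EuclideanSpace ℝ (Fin 3)) :
    ⟪fderiv ℝ (v t) x ξ, ξ⟫ ≤ δ * ‖ξ‖ ^ 2 := by
  calc ⟪fderiv ℝ (v t) x ξ, ξ⟫ ≤ ‖fderiv ℝ (v t) x ξ‖ * ‖ξ‖ := real_inner_le_norm _ _
    _ ≤ (‖fderiv ℝ (v t) x‖ * ‖ξ‖) * ‖ξ‖ :=
        mul_le_mul_of_nonneg_right ((fderiv ℝ (v t) x).le_opNorm ξ) (norm_nonneg _)
    _ ≤ (δ * ‖ξ‖) * ‖ξ‖ :=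
        mul_le_mul_of_nonneg_right (mul_le_mul_of_nonneg_right h (norm_nonneg _)) (norm_nonneg _)
    _ = δ * ‖ξ‖ ^ 2 := by ring

/-- **QUIESCENT ⟹ UNIFORMLY FADING STRAIN (class P)**: for every `δ > 0`, below some time `T < 0` the top
strain eigenvalue is at most `δ` everywhere — `⟪∇v(t,x) ξ, ξ⟫ ≤ δ‖ξ‖²` for all `t < T`, `x`, `ξ`. This is the
pointwise-in-time, UNIFORM-in-space decay of the strain majorant that any non-constant quiescent field must reconcile
with a DIVERGENT backward strain ledger. [folklore; cite: KochNadirashviliSereginSverak2009, §4] -/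
theorem strain_small_of_quiescent
    (hcont : ContinuousOn (uncurry v) (Iio 0 ×ˢ univ))
    (hbdd : ∃ K : ℝ, ∀ t < 0, ∀ x, ‖v t x‖ ≤ K)
    (hdiv : ∀ t < 0, Literature.Analysis.FluidPDE.IsWeaklyDivFree (v t))
    (hmild : ∀ s t : ℝ, s < t → t < 0 → ∀ x,
      v t x = Literature.Analysis.UnboundedOperators.heatExtension (v s) (t - s) x -
        Literature.Analysis.FluidPDE.oseenDuhamel 1 s v v t x)
    (hq : ∀ ε : ℝ, 0 < ε → ∃ T : ℝ, T < 0 ∧ ∀ t < T, ∀ x y : EuclideanSpace ℝ (Fin 3),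
      dist x y ≤ 1 → ‖v t x - v t y‖ ≤ ε) :
    ∀ δ : ℝ, 0 < δ → ∃ T : ℝ, T < 0 ∧ ∀ t < T, ∀ x ξ : EuclideanSpace ℝ (Fin 3),
      ⟪fderiv ℝ (v t) x ξ, ξ⟫ ≤ δ * ‖ξ‖ ^ 2 := by
  intro δ hδ
  obtain ⟨T, hT0, hT⟩ := fderiv_small_of_quiescent hcont hbdd hdiv hmild hq δ hδ
  exact ⟨T, hT0, fun t ht x ξ => inner_fderiv_le_of_norm_fderiv_le (hT t ht x) ξ⟩

/-- **Quiescent ⟹ uniformly small Lipschitz constant (class P)**: below `T(δ)` the slices are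
`δ`-Lipschitz, `‖v(t,x) − v(t,y)‖ ≤ δ ‖x − y‖` for ALL pairs (not only unit ones) — the global form of the dial, by the
mean value inequality on the smooth slices. [folklore] -/
theorem lipschitz_small_of_quiescent
    (hcont : ContinuousOn (uncurry v) (Iio 0 ×ˢ univ))
    (hbdd : ∃ K : ℝ, ∀ t < 0, ∀ x, ‖v t x‖ ≤ K)
    (hdiv : ∀ t < 0, Literature.Analysis.FluidPDE.IsWeaklyDivFree (v t))
    (hmild : ∀ s t : ℝ, s < t → t < 0 → ∀ x,
      v t x = Literature.Analysis.UnboundedOperators.heatExtension (v s) (t - s) x -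
        Literature.Analysis.FluidPDE.oseenDuhamel 1 s v v t x)
    (hq : ∀ ε : ℝ, 0 < ε → ∃ T : ℝ, T < 0 ∧ ∀ t < T, ∀ x y : EuclideanSpace ℝ (Fin 3),
      dist x y ≤ 1 → ‖v t x - v t y‖ ≤ ε) :
    ∀ δ : ℝ, 0 < δ → ∃ T : ℝ, T < 0 ∧ ∀ t < T, ∀ x y : EuclideanSpace ℝ (Fin 3),
      ‖v t x - v t y‖ ≤ δ * ‖x - y‖ := by
  intro δ hδ
  obtain ⟨T, hT0, hT⟩ := fderiv_small_of_quiescent hcont hbdd hdiv hmild hq δ hδ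
  refine ⟨T, hT0, fun t ht x y => ?_⟩
  have hf : Differentiable ℝ (v t) :=
    (contDiff_slice_of_classP hcont hbdd hdiv hmild (ht.trans hT0)).differentiable (by simp)
  exact (convex_univ (𝕜 := ℝ) (E := EuclideanSpace ℝ (Fin 3))).norm_image_sub_le_of_norm_fderiv_le
    (fun z _ => hf z) (fun z _ => hT t ht z) (mem_univ y) (mem_univ x)

end Strain

end Summit.NavierStokesRegularity.NavierStokesRegularity.Theorems.TypeILiouvilleQuiescentGradient

end
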